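import Summits.RiemannHypothesis.RiemannHypothesis.Theorems.PfPersistenceF1AnalyticTwinContinuum

/-!
# PF persistence, fake seat 1 — the POISSON-SIDE HONESTY TEST (FAKES §1.10, COROLLARY F1-V)

Unit `pub-rhpf-fake-1` of the `pub-rhpf` cell (mechanism / rigidity campaign; **no RH claims**).

GAP F1-G-b″ after THEOREM F1-U (file `PfPersistenceF1AnalyticTwin`): the analytic half
`AnalyticBLExt U μZ` of `BLExt U` is large, and the whole content of the gap is the ARITHMETIC honesty
condition (β) restricted to it (RULING A278 (A1)).  COROLLARY F1-V (FAKES §1.10.1, THEOREM-informal | RH)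
moves (β) to the single line `Re s = 3/2`, where everything converges absolutely: for an honest twin `μ`
represented by a g-prime system `P`, the Poisson smoothing `P[μ](1, t) = ∫ dμ(t') / (1 + (t − t')²)`
differs from `P[μZ](1, t)` by the bounded almost periodic function
`Σ_{q ≥ U} (Λ(q) − Λ_P(q)) q^{-3/2} cos(t log q)`.  This file TYPES the cheapest consequence —
(V1): the Poisson difference of an honest twin is BOUNDED UNIFORMLY IN HEIGHT — as the statement
`HonestTwinsPoissonBounded` (NOT proved here: it needs the explicit formula for `P` on the non-compactly
supported test `e^{-|x|} e^{-itx}`), and proves the bookkeeping around the test (sorry-free):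

* `PoissonBoundedDiff μ μZ` is reflexive, symmetric, transitive and CONVEX in `μ`
  (`PoissonBoundedDiff.convexComb`), so the twins passing (V1) form a convex subset of the analytic half
  containing `μZ`;
* `not_mem_blExt_of_not_poissonBoundedDiff`: granting (V1), an analytic twin that FAILS the test is not in
  `BLExt U` — the typed form of the use CONJ F1-V′ (FAKES §1.10.4: the de Branges canonical twins are
  expected to fail (V1), conditional on LEMMA S) would be put to.

Nothing about `ζ` is asserted: `μZ` enters only through the hypothesis `IsSpectralMeasure zetaC μZ`.
-/

set_option linter.dupNamespace false

noncomputable section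

open MeasureTheory Set
open scoped ENNReal

namespace Summit.RiemannHypothesis.RiemannHypothesis.Theorems.PfPersistence.Fake1.PoissonTest

open Summit.RiemannHypothesis.RiemannHypothesis.Theorems.PfPersistenceBarrier
open Summit.RiemannHypothesis.RiemannHypothesis.Theorems.PfPersistence.Fake1
open Summit.RiemannHypothesis.RiemannHypothesis.Theorems.PfPersistence.Fake1.BLExt
open Summit.RiemannHypothesis.RiemannHypothesis.Theorems.PfPersistence.Fake1.AnalyticTwin

/-- The Poisson kernel of the upper half-plane at height `1`: `1 / (1 + (t − t')²)`. [folklore] -/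
def poissonKernel (t t' : ℝ) : ℝ := 1 / (1 + (t - t') ^ 2)

/-- The kernel is positive. [folklore] -/
theorem poissonKernel_pos (t t' : ℝ) : 0 < poissonKernel t t' := by
  unfold poissonKernel
  positivity

/-- The kernel is at most `1`. [folklore] -/
theorem poissonKernel_le_one (t t' : ℝ) : poissonKernel t t' ≤ 1 := by
  unfold poissonKernel
  rw [div_le_one (by positivity)]
  nlinarith [sq_nonneg (t - t')]

/-- `P[μ](1, t) := ∫ dμ(t') / (1 + (t − t')²)`, the Poisson smoothing of `μ` at height `1`
(FAKES §1.10.0; a Bochner integral, meaningful under `PoissonIntegrable μ`). (A problem-side notion of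
the campaign; not a Literature fact.) -/
def poissonAt (μ : Measure ℝ) (t : ℝ) : ℝ := ∫ t', poissonKernel t t' ∂μ

/-- Side condition making `poissonAt μ` an honest integral: the kernel is `μ`-integrable at every
height-`1` point (true for every measure of growth `μ([T, T+1]) ≪ log T`, in particular for spectral
measures of Weil-positive `ζ`-dressed data by the translate bound F1-B). (A problem-side notion; not a
Literature fact.) -/
def PoissonIntegrable (μ : Measure ℝ) : Prop := ∀ t : ℝ, Integrable (poissonKernel t) μ

/-- **The (V1) test** (FAKES §1.10.1): `μ` and `μZ` have Poisson smoothings at height `1` that differ by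
a function BOUNDED UNIFORMLY IN THE HEIGHT `t`. (A problem-side notion; not a Literature fact.) -/
def PoissonBoundedDiff (μ μZ : Measure ℝ) : Prop :=
  PoissonIntegrable μ ∧ PoissonIntegrable μZ ∧ ∃ C : ℝ, ∀ t : ℝ, |poissonAt μ t - poissonAt μZ t| ≤ C

/-- **COROLLARY F1-V (V1), typed** (FAKES §1.10.1; THEOREM-informal | RH — NOT proved in this file):
granting a spectral measure `μZ` of `ζ`'s datum, every member of `BLExt U` (spectral measure of an
honest-below-`U`, Weil-positive, `ζ`-dressed g-prime system) passes the (V1) test against `μZ`: indeed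
`P[μ](1,t) − P[μZ](1,t) = Σ_{q ≥ U} (Λ(q) − Λ_P(q)) q^{-3/2} cos(t log q)`, absolutely convergent.
Inputs of the informal proof: the explicit formula for `P` extended to the test `e^{-|x|} e^{-itx}`
(density lemma FAKES §1.9.2 (c), dominated convergence, translate bound F1-B), and for `ζ` under RH the
Hadamard product `Re ξ'/ξ(s) = Σ_ρ Re 1/(s − ρ)`. (A problem-side statement; not a Literature fact.) -/
def HonestTwinsPoissonBounded : Prop :=
  ∀ U : ℝ, 1 < U → ∀ μZ : Measure ℝ, IsSpectralMeasure zetaC μZ → ∀ μ ∈ BLExt U, PoissonBoundedDiff μ μZ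

/-- **CONJ F1-V′, typed in its weakest useful form** (FAKES §1.10.4; CONJ, conditional on LEMMA S):
at every depth `U > 1` some analytic twin of `μZ` FAILS the (V1) test (informally: every de Branges
canonical twin does, with a Poisson ripple of amplitude `≍ log t / U` at frequency `log U`).
(A problem-side statement; not a Literature fact.) -/
def SomeAnalyticTwinFailsPoisson : Prop :=
  ∀ U : ℝ, 1 < U → ∀ μZ : Measure ℝ, IsSpectralMeasure zetaC μZ →
    ∃ μ ∈ AnalyticBLExt U μZ, ¬ PoissonBoundedDiff μ μZ

/-! ### The test is an equivalence relation, convex in the tested measure -/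

namespace PoissonBoundedDiff

/-- Reflexivity (under the integrability side condition). [folklore] -/
theorem refl {μ : Measure ℝ} (h : PoissonIntegrable μ) : PoissonBoundedDiff μ μ :=
  ⟨h, h, 0, fun t => by simp⟩

/-- Symmetry. [folklore] -/
theorem symm {μ μZ : Measure ℝ} (h : PoissonBoundedDiff μ μZ) : PoissonBoundedDiff μZ μ := by
  obtain ⟨hμ, hZ, C, hC⟩ := h
  exact ⟨hZ, hμ, C, fun t => by rw [abs_sub_comm]; exact hC t⟩

/-- Transitivity. [folklore] -/
theorem trans {μ₁ μ₂ μ₃ : Measure ℝ} (h₁₂ : PoissonBoundedDiff μ₁ μ₂) (h₂₃ : PoissonBoundedDiff μ₂ μ₃) :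
    PoissonBoundedDiff μ₁ μ₃ := by
  obtain ⟨h₁, _, C, hC⟩ := h₁₂
  obtain ⟨_, h₃, D, hD⟩ := h₂₃
  refine ⟨h₁, h₃, C + D, fun t => ?_⟩
  calc |poissonAt μ₁ t - poissonAt μ₃ t|
      = |(poissonAt μ₁ t - poissonAt μ₂ t) + (poissonAt μ₂ t - poissonAt μ₃ t)| := by
        rw [sub_add_sub_cancel]
    _ ≤ |poissonAt μ₁ t - poissonAt μ₂ t| + |poissonAt μ₂ t - poissonAt μ₃ t| := abs_add_le _ _
    _ ≤ C + D := add_le_add (hC t) (hD t)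

/-- The Poisson smoothing of a finite-weight combination is the combination of the smoothings.
[folklore] -/
theorem poissonAt_convexComb {μ₁ μ₂ : Measure ℝ} (h₁ : PoissonIntegrable μ₁) (h₂ : PoissonIntegrable μ₂)
    {c d : ℝ≥0∞} (hc : c ≠ ⊤) (hd : d ≠ ⊤) (t : ℝ) :
    poissonAt (c • μ₁ + d • μ₂) t = c.toReal * poissonAt μ₁ t + d.toReal * poissonAt μ₂ t := by
  unfold poissonAt
  rw [integral_add_measure ((h₁ t).smul_measure hc) ((h₂ t).smul_measure hd), integral_smul_measure,
    integral_smul_measure, smul_eq_mul, smul_eq_mul]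

/-- **CONVEXITY of the (V1) test**: if `μ₁` and `μ₂` pass the test against `μZ`, so does every convex
combination `c • μ₁ + d • μ₂`, `c + d = 1` (finite weights in `ℝ≥0∞`).  With
`convexComb_mem_analyticBLExt`: the analytic twins passing (V1) form a convex set containing `μZ`.
[folklore] -/
theorem convexComb {μZ μ₁ μ₂ : Measure ℝ} (h₁ : PoissonBoundedDiff μ₁ μZ) (h₂ : PoissonBoundedDiff μ₂ μZ)
    {c d : ℝ≥0∞} (hc : c ≠ ⊤) (hd : d ≠ ⊤) (hcd : c + d = 1) :
    PoissonBoundedDiff (c • μ₁ + d • μ₂) μZ := by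
  obtain ⟨hi₁, hZ, C₁, hC₁⟩ := h₁
  obtain ⟨hi₂, _, C₂, hC₂⟩ := h₂
  have hcd' : c.toReal + d.toReal = 1 := by
    rw [← ENNReal.toReal_add hc hd, hcd, ENNReal.toReal_one]
  refine ⟨fun t => ((hi₁ t).smul_measure hc).add_measure ((hi₂ t).smul_measure hd), hZ,
    c.toReal * C₁ + d.toReal * C₂, fun t => ?_⟩
  rw [poissonAt_convexComb hi₁ hi₂ hc hd]
  have key : c.toReal * poissonAt μ₁ t + d.toReal * poissonAt μ₂ t - poissonAt μZ t
      = c.toReal * (poissonAt μ₁ t - poissonAt μZ t) + d.toReal * (poissonAt μ₂ t - poissonAt μZ t) := by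
    linear_combination (poissonAt μZ t) * hcd'
  rw [key]
  calc |c.toReal * (poissonAt μ₁ t - poissonAt μZ t) + d.toReal * (poissonAt μ₂ t - poissonAt μZ t)|
      ≤ |c.toReal * (poissonAt μ₁ t - poissonAt μZ t)| + |d.toReal * (poissonAt μ₂ t - poissonAt μZ t)| :=
        abs_add_le _ _
    _ = c.toReal * |poissonAt μ₁ t - poissonAt μZ t| + d.toReal * |poissonAt μ₂ t - poissonAt μZ t| := by
        rw [abs_mul, abs_mul, abs_of_nonneg ENNReal.toReal_nonneg, abs_of_nonneg ENNReal.toReal_nonneg]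
    _ ≤ c.toReal * C₁ + d.toReal * C₂ :=
        add_le_add (mul_le_mul_of_nonneg_left (hC₁ t) ENNReal.toReal_nonneg)
          (mul_le_mul_of_nonneg_left (hC₂ t) ENNReal.toReal_nonneg)

/-- Every point of the segment from `μZ` to a twin passing the test passes the test. [folklore] -/
theorem segment {μZ μ : Measure ℝ} (hμ : PoissonBoundedDiff μ μZ) {s : ℝ} (hs0 : 0 ≤ s) (hs1 : s ≤ 1) :
    PoissonBoundedDiff (AnalyticTwin.segment μZ μ s) μZ := by
  have hZ : PoissonBoundedDiff μZ μZ := refl hμ.2.1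
  refine convexComb hμ hZ ENNReal.ofReal_ne_top ENNReal.ofReal_ne_top ?_
  rw [← ENNReal.ofReal_add hs0 (sub_nonneg.2 hs1), add_sub_cancel, ENNReal.ofReal_one]

end PoissonBoundedDiff

/-! ### What the test is for -/

/-- **Use of the test** (modus tollens on COROLLARY F1-V (V1)): granting `HonestTwinsPoissonBounded`
and a spectral measure `μZ` of `ζ`'s datum, a measure FAILING the (V1) test against `μZ` is not the
spectral measure of any honest-below-`U` Weil-positive `ζ`-dressed g-prime system. [folklore] -/
theorem not_mem_blExt_of_not_poissonBoundedDiff (hV : HonestTwinsPoissonBounded) {U : ℝ} (hU : 1 < U)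
    {μZ : Measure ℝ} (hZ : IsSpectralMeasure zetaC μZ) {μ : Measure ℝ} (hμ : ¬ PoissonBoundedDiff μ μZ) :
    μ ∉ BLExt U :=
  fun hmem => hμ (hV U hU μZ hZ μ hmem)

/-- **The closable route of row F1-G through the test, typed**: if (V1) holds for honest twins and EVERY
analytic twin other than `μZ` fails it, then `BLExt U ⊆ {μZ}` (rigidity at depth `U`).  (The second
hypothesis is NOT expected as stated — segments towards a smooth twin may pass (V1) — it records the
shape a closer via F1-V must have: a finer invariant of honest `R[μ]`, FAKES §1.10.5.) [folklore] -/
theorem blExt_subset_singleton_of_poissonTest (hV : HonestTwinsPoissonBounded) {U : ℝ} (hU : 1 < U)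
    {μZ : Measure ℝ} (hZ : IsSpectralMeasure zetaC μZ)
    (hfail : ∀ μ ∈ AnalyticBLExt U μZ, μ ≠ μZ → ¬ PoissonBoundedDiff μ μZ) :
    BLExt U ⊆ {μZ} := by
  intro μ hμ
  by_contra hne
  exact hfail μ (blExt_subset_analyticBLExt hZ U hμ) hne (hV U hU μZ hZ μ hμ)

/-- Conversely, under (V1) a single analytic twin failing the test witnesses `SomeAnalyticTwinFailsPoisson`
at that depth — and then EVERY point `s ∈ (0, 1]` of its segment from `μZ` fails too (the test is convex
and `μZ` passes), so failing twins, once one exists, come in a continuum. [folklore] -/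
theorem not_poissonBoundedDiff_segment {μZ μ : Measure ℝ} (hZi : PoissonIntegrable μZ)
    (hμi : PoissonIntegrable μ) (hμ : ¬ PoissonBoundedDiff μ μZ) {s : ℝ} (hs0 : 0 < s) (hs1 : s ≤ 1) :
    ¬ PoissonBoundedDiff (AnalyticTwin.segment μZ μ s) μZ := by
  intro hseg
  obtain ⟨_, _, C, hC⟩ := hseg
  apply hμ
  refine ⟨hμi, hZi, C / s, fun t => ?_⟩
  have hst : ENNReal.ofReal s ≠ ⊤ := ENNReal.ofReal_ne_top
  have h1t : ENNReal.ofReal (1 - s) ≠ ⊤ := ENNReal.ofReal_ne_top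
  have hseg_t := hC t
  unfold AnalyticTwin.segment at hseg_t
  rw [PoissonBoundedDiff.poissonAt_convexComb hμi hZi hst h1t, ENNReal.toReal_ofReal hs0.le,
    ENNReal.toReal_ofReal (sub_nonneg.2 hs1)] at hseg_t
  have key : s * poissonAt μ t + (1 - s) * poissonAt μZ t - poissonAt μZ t
      = s * (poissonAt μ t - poissonAt μZ t) := by ring
  rw [key, abs_mul, abs_of_pos hs0] at hseg_t
  rw [le_div_iff₀ hs0, mul_comm]
  exact hseg_t

end Summit.RiemannHypothesis.RiemannHypothesis.Theorems.PfPersistence.Fake1.PoissonTest
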